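import Summits.BirchSwinnertonDyer.BirchSwinnertonDyer.Theses.SignedLowerHalves
import Summits.BirchSwinnertonDyer.BirchSwinnertonDyer.Theorems.SignedLowerHalvesSprungLowerDivisibilityAtThreeKeyingUnpairedZero
import HarnessLib

/-!
# Negative lemma for the crux `SprungLowerDivisibilityAtThree` (item stmt-BirchSwinnertonDyer-19875): the TYPED crux is
# refuted by ONE X8 pair carrying ONE naturally-keyed dual with Kato's divisibility and ONE `ι`-UNPAIRED zero of `L^•`
# off `(p)` — the keying alarm (R-228 / T67 «P5 TRUE» / LEAD g5) with the SMALLEST hypothesis package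

Width seat `cruxlead-stmt-BirchSwinnertonDyer-19875-w3` gen 8 (prover; D-0154 KEY (146)/(147)(a) row 8; host `pub/bsd-ssimc`).
A `--negative-modulo` lemma: ONE `def … : Prop` (the hypothesis package `ContraKatoUnpairedZeroX8`, a pure `∃`, NOT
constructible in the tree today) and theorems; no named fact, no `instance`, no `sorry`. It does NOT refute the item
(the hypothesis is displayed and unconstructed) and asserts nothing about nature. **BSD is NOT proved; K1 is neither proved
nor refuted.**

## Relation to the LEAD g5 lemma `SprungLowerDivisibilityAtThree_false_of_KeyedSharpPrivateZero` (p660336)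

The LEAD's package `KeyedSharpPrivateZero` = (i) a tree-keyed `D` f.g. torsion ∧ (ii) a naturally-keyed `D′` f.g. torsion
with `pⁿ L♯ ∈ char D′.X` ∧ (iii) the keying dictionary `ℓ_𝔭 D.X = ℓ_{ι𝔭} D′.X` ∧ (iv) a private sporadic zero of `L♯`
(height one, off `(p)`, `(T)`, `(Φ₃(1+T))`, `L♭ ∉ 𝔭₀`). With the dictionary now a THEOREM
(`Sprung2012.sharpFlatSelmerDualData_lengthAt_eq_inv`, p660895) and the keying door (`ChromaticKeying.…`, p661746) the chain
runs through ideals (`ChromaticKeying.not_sprungSharpFlatLowerDivisibility_of_contraKato_of_unpairedZero`, p662114), and the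
package shrinks to `ContraKatoUnpairedZeroX8` := ONE X8 pair with the crux's binders, ANY colour `•`, ONE naturally-keyed
`D′ : SharpFlatSelmerDualData W κ γ⁻¹ … •` with `∃ n, pⁿ L^• ∈ char D′.X` (Sprung Thm. 7.16 in print keying, as a hypothesis
about this `D′` — no finiteness, no torsion clause), and ONE prime `𝔭₀ ∌ p` (any height) with `L^• ∈ 𝔭₀`, `ι(L^•) ∉ 𝔭₀`.
The LEAD's package implies this one (take `• = ♯` and the same `D′`; a private sporadic zero off `(3), (T), (Φ₃(1+T))` is
`ι`-unpaired by the tree's X8 functional equation — `ChromaticKeying.not_sprungSharpFlatLowerDivisibility_sharp_of_contraKato_of_privateZero`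
packages exactly that step), so this is the stronger lemma; the implication `KeyedSharpPrivateZero → ContraKatoUnpairedZeroX8`
is not restated here only to keep this file off the LEAD's Theses-dependent module (theses-cone lint).

What constructing `ContraKatoUnpairedZeroX8` would take (for the planner who files it): the `_contra` sibling of
`Sprung2012.thm716_sharpFlatCharIdeal_divisibility` at one X8 pair (with `thm714`'s torsion feeding it), the standard
existence packet for the leaf's binders (cyclotomic `κ`, Honda system, newform, Sprung pair — tree/Literature), and a
certified `ι`-unpaired zero of `L♯` or `L♭` at that pair (x8 census: «every coprime cell with a non-unit colour», R-228 §0).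

References: Sprung, JNT 132 (2012) Thm. 7.16, Main Conj. 7.21 [Sprung2012]; Greenberg, LNM 1716 §1 p. 60 [GreenbergLNM1716];
Sprung, ANT 11 (2017) Thm. 4.13 / Cor. 4.14 [Sprung2017] (the FE used to compare with the LEAD's package).
-/

set_option autoImplicit false
-- the problem directory `BirchSwinnertonDyer/BirchSwinnertonDyer` forces the duplicated namespace segment
set_option linter.dupNamespace false

noncomputable section

open scoped Classical NumberField MatrixGroups ModularForm

open NumberField IsDedekindDomain CongruenceSubgroup WeierstrassCurve PowerSeries
  Literature.NumberTheory.EllipticCurves Literature.NumberTheory.EllipticCurves.ModularForms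
  Literature.NumberTheory.EllipticCurves.ZpExtension Literature.NumberTheory.EllipticCurves.Sprung2017
  Literature.NumberTheory.EllipticCurves.Sprung2012 Literature.NumberTheory.EllipticCurves.Rank1Residual
  Literature.NumberTheory.EllipticCurves.IwasawaAlgebra Literature.Barriers.BirchSwinnertonDyer

namespace Summit.BirchSwinnertonDyer.BirchSwinnertonDyer.Theorems

/-- **The hypothesis `H″` of the negative lemma: ONE X8 pair with a naturally-keyed Kato divisibility and an `ι`-unpaired
zero** (a pure `∃`-package; nothing asserted; NOT constructible in the tree today). In the setting of the crux's own binders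
(X8 pair `(W, p)`, cyclotomic `(κ, γ)` with `IsCyclotomicVariable p γ`, place `v ∣ p`, local lift `g`, Honda system `(cneg, c)`,
newform `f`, period ratio `ϖ`, Sprung pair `(L♯, L♭)`) and a colour `•`: (a) a naturally (contragrediently) keyed dual datum
`D′ : SharpFlatSelmerDualData W κ γ⁻¹ … •` with Kato's divisibility `pⁿ·L^• ∈ char D′.X` for some `n` (Sprung 2012 Thm. 7.16
in print keying); (b) a prime `𝔭₀` of `Λ` with `p ∉ 𝔭₀`, `L^• ∈ 𝔭₀` and `ι(L^•) ∉ 𝔭₀` (`ι = IwasawaAlgebra.invol p`). (Sources,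
prose only — a hypothesis package, not a citable fact: Sprung 2012 Thm. 7.14 / 7.16; Greenberg 1989 §0 for `ι`; x8 R-228 / T67
for the keying.) -/
def ContraKatoUnpairedZeroX8 : Prop :=
  ∃ (W : WeierstrassCurve ℚ) (_ : W.IsElliptic) (_ : W.IsGloballyMinimal) (p : ℕ) (_ : Fact p.Prime)
    (_ : ClassX8 W p) (κ : ZpExtension ℚ p) (γ : Field.absoluteGaloisGroup ℚ)
    (_ : κ.IsCyclotomic) (_ : κ.IsTopGenerator γ) (_ : IsCyclotomicVariable p γ)
    (v : HeightOneSpectrum (𝓞 ℚ)) (_ : (p : 𝓞 ℚ) ∈ v.asIdeal)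
    (g : Field.absoluteGaloisGroup (v.adicCompletion ℚ))
    (_ : κ.IsTopGenerator (resGalOfEmb (closureEmb (K := ℚ) (v.adicCompletion ℚ)) g))
    (cneg : localPoints W (v.adicCompletion ℚ)) (c : ℕ → localPoints W (v.adicCompletion ℚ))
    (_ : IsHondaSystem κ (closureEmb (K := ℚ) (v.adicCompletion ℚ)) W (W.frobeniusTrace p) g cneg c)
    (N : ℕ) (_ : NeZero N) (f : CuspForm (Gamma0 N) 2) (ϖ : ℚ) (Lsharp Lflat : IwasawaAlgebra p)
    (_ : IsNewformOf W f) (_ : (ϖ : ℝ) * W.realPeriodRat = plusPeriod f)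
    (_ : IsSprungPair f p (W.frobeniusTrace p) Lsharp Lflat) (col : Chroma)
    -- (a) a naturally keyed dual of `Sel^•` with Kato's divisibility in print keying
    (D' : SharpFlatSelmerDualData W κ γ⁻¹ (closureEmb (K := ℚ) (v.adicCompletion ℚ)) (W.frobeniusTrace p) g c col)
    (_ : ∃ n : ℕ, (p : IwasawaAlgebra p) ^ n * chromaticL col Lsharp Lflat ∈ D'.charIdeal)
    -- (b) an `ι`-unpaired zero of `L^•` off `(p)`
    (𝔭₀ : PrimeSpectrum (IwasawaAlgebra p)),
    (p : IwasawaAlgebra p) ∉ 𝔭₀.asIdeal ∧ chromaticL col Lsharp Lflat ∈ 𝔭₀.asIdeal ∧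
      invol p (chromaticL col Lsharp Lflat) ∉ 𝔭₀.asIdeal

/-- **NEGATIVE LEMMA (smallest package): `ContraKatoUnpairedZeroX8 → ¬ SprungLowerDivisibilityAtThree`.** At the witness
pair and colour the crux gives the typed leaf `Theorems.SprungSharpFlatLowerDivisibility W p •`, which
`ChromaticKeying.not_sprungSharpFlatLowerDivisibility_of_contraKato_of_unpairedZero` refutes from (a) and (b): through the
keying door the leaf says `char D′.X = (gen)`, `gen^ℚ = ϖ·(ι(L^•)·h)^ℚ`; with `pⁿ L^• ∈ (gen)` this forces every zero of
`L^•` off `(p)` to be `ι`-paired. NOTHING about Sprung's conjecture is refuted: under the contragredient repair C′ of the leaf,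
(a) is Sprung's own Thm. 7.16 for `D′` and the door's `ι` disappears. The guard `L^• ≠ 0` of the leaf is met on X8
(`ChromaticBothColours.ClassX8.chromaticL_ne_zero`). [cite: Sprung2012, Thm. 7.16 (p. 1504), Main Conj. 7.21 (p. 1505)]
[cite: GreenbergLNM1716, §1 (p. 60)] -/
theorem SprungLowerDivisibilityAtThree_false_of_ContraKatoUnpairedZeroX8 :
    ContraKatoUnpairedZeroX8 →
      ¬ Summit.BirchSwinnertonDyer.BirchSwinnertonDyer.Theses.SignedLowerHalves.SprungLowerDivisibilityAtThree := by
  rintro ⟨W, hE, hGM, p, hp, hX, κ, γ, hκ, hγ, hcv, v, hv, g, hg, cneg, c, hH, N, hN, f, ϖ, Lsharp, Lflat, hf, hϖ, hSP,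
    col, D', hKato, 𝔭₀, hp𝔭₀, hL𝔭₀, hιL𝔭₀⟩ hK1
  haveI : NeZero N := hN
  have hne : chromaticL col Lsharp Lflat ≠ 0 :=
    ChromaticBothColours.ClassX8.chromaticL_ne_zero W p hX f Lsharp Lflat hf hSP col
  exact ChromaticKeying.not_sprungSharpFlatLowerDivisibility_of_contraKato_of_unpairedZero W p col κ γ hκ hγ hcv v hv
    g hg cneg c hH N hN f ϖ Lsharp Lflat hf hϖ hSP hne D' hKato 𝔭₀ hp𝔭₀ hL𝔭₀ hιL𝔭₀ (hK1 W p hX col)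

end Summit.BirchSwinnertonDyer.BirchSwinnertonDyer.Theorems

end
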